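import Mathlib.Analysis.SpecialFunctions.Exp
import Mathlib.Analysis.SpecialFunctions.Log.Basic
import Mathlib.Algebra.Order.Floor.Defs
import Mathlib.Algebra.BigOperators.Field
import Mathlib.Data.Fintype.BigOperators
import HarnessLib

/-!
# Concentration of the weighted degree of monomials (BCCGU 2017, Thm. 3.11, by exponential moments)

Topic `Literature/Barriers/MatrixMultiplication`; fifth file attached to the catalogue entry
`NilpotentGroupBarrier.lean` (towards the discharge of `BCCGU2017_cor320`,
Blasiak–Church–Cohn–Grochow–Umans 2017, Cor. 3.20). Pure real analysis, independent of the
group theory.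

BCCGU 2017, Thm. 3.11 bounds `dim I^{2s/3}` (and, by symmetry, `codim I^{s/3}`) by counting
Jennings monomials `∏ x_{j,i}^{m_{j,i}}` (`0 ≤ m < p`) of weighted degree far from the mean,
"by Hoeffding's Inequality" (held text `paper:arxiv-1712.02302`, p. 7). We prove the counting
statement we need in the form: for exponent vectors `e ∈ [0,p)^ι` with weights `1 ≤ w_a ≤ W_max`,
weighted degree `deg e = Σ_a e_a w_a` (maximal value `K = (p-1)Σ w_a`, mean `K/2`) and threshold
`t = ⌈3K/8⌉`, BOTH `#{deg < t}` and `#{deg ≥ 2t}` are at most `ρ^{|ι|} p^{|ι|}` with a rate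
`ρ = ρ(p, W_max) < 1` independent of `ι` and of the weights (`exists_tail_decay`). Instead of
Hoeffding's inequality we use exponential moments directly: `#{deg ≥ 2t} ≤ Σ_e exp(λ(deg e - 3K/4))
= ∏_a Σ_{k<p} exp(λ w_a (k - 3(p-1)/4))` and the one-letter bound
`Σ_{k<p} exp(λ w (k - 3(p-1)/4)) ≤ p(1 - λ(p-1)/8)` for `λ = (p-1)/(8p²W_max)`
(`sum_exp_upper_le`, from `exp x ≤ 1 + x + x²` on `|x| ≤ 1`), and symmetrically for the lower
tail (`sum_exp_lower_le`, `μ = (p-1)/(16p²W_max)`). The constants are crude; only `ρ < 1` matters.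

Source: J. Blasiak, T. Church, H. Cohn, J. A. Grochow, C. Umans, *Which groups are amenable to
proving exponent two for matrix multiplication?*, arXiv:1712.02302
[BlasiakChurchCohnGrochowUmans2017], Thm. 3.11 and its proof (p. 7 of the held text).
-/

noncomputable section

open scoped BigOperators
open Finset Real

namespace Literature.Barriers.MatrixMultiplication

/-! ## The elementary exponential inequality -/

/-- `exp x ≤ 1 + x + x²` for `|x| ≤ 1`. [folklore] -/
theorem exp_le_one_add_add_sq {x : ℝ} (hx : |x| ≤ 1) : Real.exp x ≤ 1 + x + x ^ 2 := by
  have h := Real.abs_exp_sub_one_sub_id_le hx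
  have := (abs_le.1 h).2
  linarith

/-- **One-letter moment bound, upper tail**: for `p ≥ 2`, `1 ≤ w ≤ W` and
`λ = (p-1)/(8p²W)`, `Σ_{k<p} exp(λw(k - 3(p-1)/4)) ≤ p(1 - λ(p-1)/8)`. [folklore] -/
theorem sum_exp_upper_le {p : ℕ} (hp : 2 ≤ p) {w W : ℝ} (hw1 : 1 ≤ w) (hwW : w ≤ W) :
    ∑ k ∈ Finset.range p, Real.exp ((p - 1 : ℝ) / (8 * p ^ 2 * W) * w * (k - 3 * (p - 1) / 4)) ≤
      p * (1 - (p - 1 : ℝ) / (8 * p ^ 2 * W) * (p - 1) / 8) := by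
  set lam : ℝ := (p - 1 : ℝ) / (8 * p ^ 2 * W) with hlam
  have hp' : (2 : ℝ) ≤ p := by exact_mod_cast hp
  have hW : 1 ≤ W := hw1.trans hwW
  have hp1 : (0 : ℝ) ≤ p - 1 := by linarith
  have hlam0 : 0 ≤ lam := by rw [hlam]; exact div_nonneg hp1 (by positivity)
  have hlamW : lam * W * p = (p - 1) / (8 * p) := by
    rw [hlam]; field_simp
  have hlamw : lam * w * p ≤ (p - 1) / (8 * p) := by
    rw [← hlamW]; gcongr
  have hsmall : lam * w * p ≤ 1 := by
    refine hlamw.trans ?_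
    rw [div_le_one (by positivity)]; linarith
  -- termwise bound
  have hterm : ∀ k ∈ Finset.range p,
      Real.exp (lam * w * (k - 3 * (p - 1) / 4)) ≤
        1 + lam * w * (k - 3 * (p - 1) / 4) + (lam * w * p) ^ 2 := by
    intro k hk
    have hk' : (k : ℝ) < p := by exact_mod_cast Finset.mem_range.1 hk
    have hk0 : (0 : ℝ) ≤ k := by positivity
    have habs : |(k : ℝ) - 3 * (p - 1) / 4| ≤ p := by
      rw [abs_le]; constructor <;> linarith
    have hx : |lam * w * (k - 3 * (p - 1) / 4)| ≤ lam * w * p := by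
      rw [abs_mul, abs_of_nonneg (by positivity : 0 ≤ lam * w)]
      exact mul_le_mul_of_nonneg_left habs (by positivity)
    refine (exp_le_one_add_add_sq (hx.trans hsmall)).trans ?_
    have : (lam * w * (k - 3 * (p - 1) / 4)) ^ 2 ≤ (lam * w * p) ^ 2 := by
      rw [← sq_abs]
      exact pow_le_pow_left₀ (abs_nonneg _) hx 2
    linarith
  refine (Finset.sum_le_sum hterm).trans ?_
  -- `Σ_{k<p} k = p(p-1)/2`
  have hsum : ∑ k ∈ Finset.range p, (k : ℝ) = p * (p - 1) / 2 := by
    have h := Finset.sum_range_id_mul_two p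
    have h' : ((∑ k ∈ Finset.range p, k : ℕ) : ℝ) * 2 = p * (p - 1 : ℕ) := by exact_mod_cast h
    rw [Nat.cast_sub (by omega), Nat.cast_sum] at h'
    push_cast at h'
    linarith
  have hS : ∑ k ∈ Finset.range p, (1 + lam * w * (k - 3 * (p - 1) / 4) + (lam * w * p) ^ 2) =
      p + lam * w * (p * (p - 1) / 2 - p * (3 * (p - 1) / 4)) + p * (lam * w * p) ^ 2 := by
    rw [Finset.sum_add_distrib, Finset.sum_add_distrib, Finset.sum_const, Finset.card_range,
      nsmul_eq_mul, mul_one, Finset.sum_const, Finset.card_range, nsmul_eq_mul, ← Finset.mul_sum,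
      Finset.sum_sub_distrib, Finset.sum_const, Finset.card_range, nsmul_eq_mul, hsum]
  rw [hS]
  -- the quadratic term is at most half the linear gain
  have hquad : (p : ℝ) * (lam * w * p) ^ 2 ≤ lam * w * p * (p - 1) / 8 := by
    have h2 : (p : ℝ) * (lam * w * p) ≤ (p - 1) / 8 := by
      calc (p : ℝ) * (lam * w * p) ≤ p * ((p - 1) / (8 * p)) := by gcongr
        _ = (p - 1) / 8 := by field_simp
    calc (p : ℝ) * (lam * w * p) ^ 2 = lam * w * p * (p * (lam * w * p)) := by ring
      _ ≤ lam * w * p * ((p - 1) / 8) := mul_le_mul_of_nonneg_left h2 (by positivity)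
      _ = lam * w * p * (p - 1) / 8 := by ring
  have hw' : lam * p * (p - 1) ≤ lam * w * p * (p - 1) := by
    have : 0 ≤ lam * p * (p - 1) := by positivity
    nlinarith
  nlinarith [hquad, hw']

/-- **One-letter moment bound, lower tail**: for `p ≥ 2`, `1 ≤ w ≤ W` and
`μ = (p-1)/(16p²W)`, `Σ_{k<p} exp(-μw(k - 3(p-1)/8)) ≤ p(1 - μ(p-1)/16)`. [folklore] -/
theorem sum_exp_lower_le {p : ℕ} (hp : 2 ≤ p) {w W : ℝ} (hw1 : 1 ≤ w) (hwW : w ≤ W) :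
    ∑ k ∈ Finset.range p, Real.exp (-((p - 1 : ℝ) / (16 * p ^ 2 * W) * w * (k - 3 * (p - 1) / 8))) ≤
      p * (1 - (p - 1 : ℝ) / (16 * p ^ 2 * W) * (p - 1) / 16) := by
  set mu : ℝ := (p - 1 : ℝ) / (16 * p ^ 2 * W) with hmu
  have hp' : (2 : ℝ) ≤ p := by exact_mod_cast hp
  have hW : 1 ≤ W := hw1.trans hwW
  have hp1 : (0 : ℝ) ≤ p - 1 := by linarith
  have hmu0 : 0 ≤ mu := by rw [hmu]; exact div_nonneg hp1 (by positivity)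
  have hmuW : mu * W * p = (p - 1) / (16 * p) := by
    rw [hmu]; field_simp
  have hmuw : mu * w * p ≤ (p - 1) / (16 * p) := by
    rw [← hmuW]; gcongr
  have hsmall : mu * w * p ≤ 1 := by
    refine hmuw.trans ?_
    rw [div_le_one (by positivity)]; linarith
  have hterm : ∀ k ∈ Finset.range p,
      Real.exp (-(mu * w * (k - 3 * (p - 1) / 8))) ≤
        1 + -(mu * w * (k - 3 * (p - 1) / 8)) + (mu * w * p) ^ 2 := by
    intro k hk
    have hk' : (k : ℝ) < p := by exact_mod_cast Finset.mem_range.1 hk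
    have hk0 : (0 : ℝ) ≤ k := by positivity
    have habs : |(k : ℝ) - 3 * (p - 1) / 8| ≤ p := by
      rw [abs_le]; constructor <;> linarith
    have hx : |-(mu * w * (k - 3 * (p - 1) / 8))| ≤ mu * w * p := by
      rw [abs_neg, abs_mul, abs_of_nonneg (by positivity : 0 ≤ mu * w)]
      exact mul_le_mul_of_nonneg_left habs (by positivity)
    refine (exp_le_one_add_add_sq (hx.trans hsmall)).trans ?_
    have : (-(mu * w * (k - 3 * (p - 1) / 8))) ^ 2 ≤ (mu * w * p) ^ 2 := by
      rw [← sq_abs]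
      exact pow_le_pow_left₀ (abs_nonneg _) hx 2
    linarith
  refine (Finset.sum_le_sum hterm).trans ?_
  have hsum : ∑ k ∈ Finset.range p, (k : ℝ) = p * (p - 1) / 2 := by
    have h := Finset.sum_range_id_mul_two p
    have h' : ((∑ k ∈ Finset.range p, k : ℕ) : ℝ) * 2 = p * (p - 1 : ℕ) := by exact_mod_cast h
    rw [Nat.cast_sub (by omega), Nat.cast_sum] at h'
    push_cast at h'
    linarith
  have hS : ∑ k ∈ Finset.range p, (1 + -(mu * w * (k - 3 * (p - 1) / 8)) + (mu * w * p) ^ 2) =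
      p - mu * w * (p * (p - 1) / 2 - p * (3 * (p - 1) / 8)) + p * (mu * w * p) ^ 2 := by
    rw [Finset.sum_add_distrib, Finset.sum_add_distrib, Finset.sum_const, Finset.card_range,
      nsmul_eq_mul, mul_one, Finset.sum_const, Finset.card_range, nsmul_eq_mul, Finset.sum_neg_distrib,
      ← Finset.mul_sum, Finset.sum_sub_distrib, Finset.sum_const, Finset.card_range, nsmul_eq_mul, hsum]
    ring
  rw [hS]
  have hquad : (p : ℝ) * (mu * w * p) ^ 2 ≤ mu * w * p * (p - 1) / 16 := by
    have h2 : (p : ℝ) * (mu * w * p) ≤ (p - 1) / 16 := by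
      calc (p : ℝ) * (mu * w * p) ≤ p * ((p - 1) / (16 * p)) := by gcongr
        _ = (p - 1) / 16 := by field_simp
    calc (p : ℝ) * (mu * w * p) ^ 2 = mu * w * p * (p * (mu * w * p)) := by ring
      _ ≤ mu * w * p * ((p - 1) / 16) := mul_le_mul_of_nonneg_left h2 (by positivity)
      _ = mu * w * p * (p - 1) / 16 := by ring
  have hw' : mu * p * (p - 1) ≤ mu * w * p * (p - 1) := by
    have : 0 ≤ mu * p * (p - 1) := by positivity
    nlinarith
  nlinarith [hquad, hw']

/-! ## Both tails of the weighted degree are exponentially small -/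

/-- The generating function of the weighted degree factorises over the letters. [folklore] -/
theorem sum_exp_deg_eq_prod {ι : Type*} [Fintype ι] [DecidableEq ι] (p : ℕ) (w : ι → ℕ) (c s : ℝ) :
    ∑ e : ι → Fin p, Real.exp (c * ∑ a, (w a : ℝ) * ((e a : ℕ) - s)) =
      ∏ a, ∑ k ∈ Finset.range p, Real.exp (c * w a * (k - s)) := by
  have h1 : ∀ e : ι → Fin p, Real.exp (c * ∑ a, (w a : ℝ) * ((e a : ℕ) - s)) =
      ∏ a, Real.exp (c * w a * ((e a : ℕ) - s)) := fun e => by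
    rw [Finset.mul_sum, Real.exp_sum]
    refine Finset.prod_congr rfl fun a _ => ?_
    ring_nf
  simp_rw [h1]
  rw [← Fintype.prod_sum (fun a (k : Fin p) => Real.exp (c * w a * ((k : ℕ) - s)))]
  refine Finset.prod_congr rfl fun a _ => ?_
  exact (Fin.sum_univ_eq_sum_range (fun k => Real.exp (c * w a * (k - s))) p)

/-- **Both tails of the weighted degree are exponentially small** (the concentration step of
BCCGU 2017, Thm. 3.11, with exponential moments instead of Hoeffding's inequality and for
arbitrary weights `1 ≤ w_a ≤ W_max`): there is `ρ < 1` depending only on `p` and `W_max` such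
that for every finite alphabet `ι` and threshold `t = ⌈3K/8⌉`, `K = (p-1)Σ w_a` the maximal degree,
`#{e ∈ [0,p)^ι : deg e < t} ≤ ρ^{|ι|} p^{|ι|}` and `#{e : deg e ≥ 2t} ≤ ρ^{|ι|} p^{|ι|}`, where
`deg e = Σ_a e_a w_a` (mean `K/2`). [cite: BlasiakChurchCohnGrochowUmans2017, Thm. 3.11] -/
theorem exists_tail_decay {p : ℕ} (hp : 2 ≤ p) {Wmax : ℕ} (hWmax : 1 ≤ Wmax) :
    ∃ ρ : ℝ, 0 < ρ ∧ ρ < 1 ∧ ∀ (ι : Type) [Fintype ι] [DecidableEq ι] (w : ι → ℕ),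
      (∀ a, 1 ≤ w a) → (∀ a, w a ≤ Wmax) → ∃ t : ℕ,
        (Fintype.card {e : ι → Fin p // ∑ a, (e a : ℕ) * w a < t} : ℝ) ≤
            ρ ^ Fintype.card ι * (p : ℝ) ^ Fintype.card ι ∧
          (Fintype.card {e : ι → Fin p // t + t ≤ ∑ a, (e a : ℕ) * w a} : ℝ) ≤
            ρ ^ Fintype.card ι * (p : ℝ) ^ Fintype.card ι := by
  classical
  have hp' : (2 : ℝ) ≤ p := by exact_mod_cast hp
  have hW' : (1 : ℝ) ≤ Wmax := by exact_mod_cast hWmax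
  set lam : ℝ := (p - 1 : ℝ) / (8 * p ^ 2 * Wmax) with hlam
  set mu : ℝ := (p - 1 : ℝ) / (16 * p ^ 2 * Wmax) with hmu
  set ρ : ℝ := 1 - mu * (p - 1) / 16 with hρ
  have hp1 : (1 : ℝ) ≤ p - 1 := by linarith
  have hmu0 : 0 < mu := by rw [hmu]; positivity
  have hlam0 : 0 < lam := by rw [hlam]; positivity
  have hmu1 : mu * (p - 1) / 16 < 1 := by
    -- `mu (p-1) ≤ 1/16`
    have h1 : mu * (p - 1) = (p - 1) ^ 2 / (16 * p ^ 2 * Wmax) := by rw [hmu]; ring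
    rw [h1]
    have h2 : (p - 1 : ℝ) ^ 2 ≤ 16 * p ^ 2 * Wmax := by nlinarith
    have h3 : (p - 1 : ℝ) ^ 2 / (16 * p ^ 2 * Wmax) ≤ 1 := (div_le_one (by positivity)).2 h2
    linarith
  have hρ0 : 0 < ρ := by rw [hρ]; linarith
  have hρ1 : ρ < 1 := by
    rw [hρ]
    have : 0 < mu * (p - 1) / 16 := by positivity
    linarith
  -- the upper-tail rate is the better one
  have hρ' : 1 - lam * (p - 1) / 8 ≤ ρ := by
    rw [hρ, hlam, hmu]
    have : 0 ≤ (p - 1 : ℝ) * (p - 1) / (p ^ 2 * Wmax) :=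
      div_nonneg (by nlinarith) (by positivity)
    have e1 : (p - 1 : ℝ) / (8 * p ^ 2 * Wmax) * (p - 1) / 8 = (p - 1) * (p - 1) / (p ^ 2 * Wmax) / 64 := by
      field_simp; ring
    have e2 : (p - 1 : ℝ) / (16 * p ^ 2 * Wmax) * (p - 1) / 16 = (p - 1) * (p - 1) / (p ^ 2 * Wmax) / 256 := by
      field_simp; ring
    rw [e1, e2]; linarith
  refine ⟨ρ, hρ0, hρ1, fun ι _ _ w hw1 hwW => ?_⟩
  set n := Fintype.card ι with hn
  set K : ℝ := (p - 1 : ℝ) * ∑ a, (w a : ℝ) with hK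
  have hK0 : 0 ≤ K := by
    rw [hK]; exact mul_nonneg (by linarith) (Finset.sum_nonneg fun a _ => Nat.cast_nonneg _)
  set t : ℕ := ⌈3 * K / 8⌉₊ with ht
  have ht1 : (t : ℝ) < 3 * K / 8 + 1 := Nat.ceil_lt_add_one (by positivity)
  have ht2 : 3 * K / 8 ≤ t := Nat.le_ceil _
  refine ⟨t, ?_, ?_⟩
  · -- lower tail
    have hcount : (Fintype.card {e : ι → Fin p // ∑ a, (e a : ℕ) * w a < t} : ℝ) =
        ∑ e : ι → Fin p, if ∑ a, (e a : ℕ) * w a < t then (1 : ℝ) else 0 := by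
      rw [Fintype.card_subtype, Finset.sum_boole]
    rw [hcount]
    calc ∑ e : ι → Fin p, (if ∑ a, (e a : ℕ) * w a < t then (1 : ℝ) else 0)
        ≤ ∑ e : ι → Fin p, Real.exp (-mu * ∑ a, (w a : ℝ) * ((e a : ℕ) - 3 * (p - 1) / 8)) := by
          refine Finset.sum_le_sum fun e _ => ?_
          split_ifs with h
          · -- the exponent is non-negative
            have hdeg : (∑ a, ((e a : ℕ) : ℝ) * w a) ≤ t - 1 := by
              have : ∑ a, (e a : ℕ) * w a + 1 ≤ t := h
              have h' : ((∑ a, (e a : ℕ) * w a + 1 : ℕ) : ℝ) ≤ t := by exact_mod_cast this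
              push_cast at h'
              linarith
            have hexp : 0 ≤ -mu * ∑ a, (w a : ℝ) * ((e a : ℕ) - 3 * (p - 1) / 8) := by
              have e1 : ∑ a, (w a : ℝ) * ((e a : ℕ) - 3 * (p - 1) / 8) =
                  ∑ a, ((e a : ℕ) : ℝ) * w a - 3 * K / 8 := by
                calc ∑ a, (w a : ℝ) * ((e a : ℕ) - 3 * (p - 1) / 8)
                    = ∑ a, (((e a : ℕ) : ℝ) * w a - 3 * (p - 1) / 8 * w a) :=
                      Finset.sum_congr rfl fun a _ => by ring
                  _ = ∑ a, ((e a : ℕ) : ℝ) * w a - ∑ a, 3 * (p - 1) / 8 * (w a : ℝ) :=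
                      Finset.sum_sub_distrib _ _
                  _ = _ := by rw [← Finset.mul_sum, hK]; ring
              rw [e1, neg_mul]
              have : ∑ a, ((e a : ℕ) : ℝ) * w a - 3 * K / 8 ≤ 0 := by linarith
              nlinarith
            exact Real.one_le_exp hexp
          · exact (Real.exp_pos _).le
      _ = ∏ a, ∑ k ∈ Finset.range p, Real.exp (-mu * w a * (k - 3 * (p - 1) / 8)) :=
          sum_exp_deg_eq_prod p w (-mu) _
      _ ≤ ∏ _a : ι, (p : ℝ) * ρ := by
          refine Finset.prod_le_prod (fun a _ => Finset.sum_nonneg fun k _ => (Real.exp_pos _).le)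
            fun a _ => ?_
          have h := sum_exp_lower_le hp (w := w a) (W := Wmax) (by exact_mod_cast hw1 a)
            (by exact_mod_cast hwW a)
          refine le_trans (le_of_eq (Finset.sum_congr rfl fun k _ => ?_)) h
          congr 1; rw [hmu]; ring
      _ = ρ ^ n * (p : ℝ) ^ n := by
          rw [Finset.prod_const, Finset.card_univ, ← hn, mul_pow, mul_comm]
  · -- upper tail
    have hcount : (Fintype.card {e : ι → Fin p // t + t ≤ ∑ a, (e a : ℕ) * w a} : ℝ) =
        ∑ e : ι → Fin p, if t + t ≤ ∑ a, (e a : ℕ) * w a then (1 : ℝ) else 0 := by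
      rw [Fintype.card_subtype, Finset.sum_boole]
    rw [hcount]
    calc ∑ e : ι → Fin p, (if t + t ≤ ∑ a, (e a : ℕ) * w a then (1 : ℝ) else 0)
        ≤ ∑ e : ι → Fin p, Real.exp (lam * ∑ a, (w a : ℝ) * ((e a : ℕ) - 3 * (p - 1) / 4)) := by
          refine Finset.sum_le_sum fun e _ => ?_
          split_ifs with h
          · have hdeg : (t : ℝ) + t ≤ ∑ a, ((e a : ℕ) : ℝ) * w a := by
              have h' : ((t + t : ℕ) : ℝ) ≤ ((∑ a, (e a : ℕ) * w a : ℕ) : ℝ) := by exact_mod_cast h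
              push_cast at h'
              exact h'
            have hexp : 0 ≤ lam * ∑ a, (w a : ℝ) * ((e a : ℕ) - 3 * (p - 1) / 4) := by
              have e1 : ∑ a, (w a : ℝ) * ((e a : ℕ) - 3 * (p - 1) / 4) =
                  ∑ a, ((e a : ℕ) : ℝ) * w a - 3 * K / 4 := by
                calc ∑ a, (w a : ℝ) * ((e a : ℕ) - 3 * (p - 1) / 4)
                    = ∑ a, (((e a : ℕ) : ℝ) * w a - 3 * (p - 1) / 4 * w a) :=
                      Finset.sum_congr rfl fun a _ => by ring
                  _ = ∑ a, ((e a : ℕ) : ℝ) * w a - ∑ a, 3 * (p - 1) / 4 * (w a : ℝ) :=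
                      Finset.sum_sub_distrib _ _
                  _ = _ := by rw [← Finset.mul_sum, hK]; ring
              rw [e1]
              have : 0 ≤ ∑ a, ((e a : ℕ) : ℝ) * w a - 3 * K / 4 := by linarith
              positivity
            exact Real.one_le_exp hexp
          · exact (Real.exp_pos _).le
      _ = ∏ a, ∑ k ∈ Finset.range p, Real.exp (lam * w a * (k - 3 * (p - 1) / 4)) :=
          sum_exp_deg_eq_prod p w lam _
      _ ≤ ∏ _a : ι, (p : ℝ) * ρ := by
          refine Finset.prod_le_prod (fun a _ => Finset.sum_nonneg fun k _ => (Real.exp_pos _).le)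
            fun a _ => ?_
          have h := sum_exp_upper_le hp (w := w a) (W := Wmax) (by exact_mod_cast hw1 a)
            (by exact_mod_cast hwW a)
          refine le_trans (le_trans (le_of_eq (Finset.sum_congr rfl fun k _ => ?_)) h) ?_
          · congr 1
          · have hp0 : (0 : ℝ) ≤ p := by positivity
            calc (p : ℝ) * (1 - (p - 1 : ℝ) / (8 * p ^ 2 * Wmax) * (p - 1) / 8) = p * (1 - lam * (p - 1) / 8) := by
                  rw [hlam]
              _ ≤ p * ρ := mul_le_mul_of_nonneg_left hρ' hp0
      _ = ρ ^ n * (p : ℝ) ^ n := by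
          rw [Finset.prod_const, Finset.card_univ, ← hn, mul_pow, mul_comm]

end Literature.Barriers.MatrixMultiplication

end
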